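import Mathlib
import HarnessLib
import Summits.NavierStokesRegularity.NavierStokesRegularity.Theorems.LocalVelCompTubeDoorLocalPointZoomVelSlices
import Summits.NavierStokesRegularity.NavierStokesRegularity.Theorems.PoloidalWindowDoorPoloidalWindowRigidityAxisymmetric
import Summits.NavierStokesRegularity.NavierStokesRegularity.Theorems.LocalHelicityTubeDoorFrobeniusProfileRigiditySharper

/-!
# The door family in the classical AXISYMMETRIC-WITHOUT-SWIRL regime: local Type I alone already forces backward
# boundedness — the S-restricted case `TargetAxisymNoSwirlCase` of door S11 (and of every window door) is a THEOREM

Cell ns-regularity-ideate, seat p6 (route-directed support for the door routes of LADDER-NS N0; first consumer: the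
tribunal `s_case` of door S11 `LocalHelicityTubeDoor`, nsreg-p1 g11's `bc/rendered-with-scase.lean`
`TargetAxisymNoSwirlCase`, there described as «known IN PRINT (Ladyzhenskaya 1968, Ukhovskii–Yudovich 1968; KNSS 2009 /
Seregin–Šverák 2009) though NOT a tree theorem»).  This file makes it a tree theorem BY THE DOOR'S OWN MECHANISM
(blow-up zoom + profile strata), with no window hypothesis at all:

* `isBackwardBoundedAt_of_localTypeI_axisymmetric_noSwirl` — **local Type I at `(x₀, T)` + axisymmetric without swirl
  at every time ⇒ backward bounded at `(x₀, T)`**, for a classical Leray–Hopf solution from a rapidly decaying datum and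
  ANY point `x₀` (on or off the axis).  Proof: if not, the velocity zoom of the family (tree `localPointZoomVelSlices`,
  S10's crux K1′: `(λⱼ/ν) u(T + λⱼ²s/ν, x₀ + λⱼ y) → v(s,y)` pointwise, `v` a backward-singular profile of the Type-I
  class) inherits the symmetry in one of two ways.  No swirl reads `⟪J x, u(t,x)⟫ = 0` with `J x = (−x₁, x₀, 0)` the
  rotation generator (tree `swirl_eq_inner_rotGen`), and `J(x₀ + λⱼ y) = J x₀ + λⱼ J y`:
  - OFF the axis (`J x₀ ≠ 0`): in the limit `⟪v(s,y), J x₀⟫ = 0` for all `s < 0`, `y` — one Cartesian velocity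
    component of the profile vanishes identically, the STRICT-SHADOW stratum (S10's crux K2′, tree
    `not_backwardSingular_of_inner_eq_zero`), so `v` is not backward-singular: contradiction;
  - ON the axis (`J x₀ = 0`, i.e. `x₀ = (0,0,z₀)`): `R_θ (x₀ + λⱼ y) = x₀ + λⱼ R_θ y`, so every rescaled slice is
    axisymmetric and (from `λⱼ ⟪J y, uⱼ⟫ = 0`) swirl-free, hence so is the pointwise limit; KNSS 2009 Thm 5.2 in the
    class (tree `eq_zero_of_axisymmetric_noSwirl`) gives `v ≡ 0`: contradiction.
* `targetAxisymNoSwirlCase` — **the S-restricted case of the S11 leaf, VERBATIM nsreg-p1's `TargetAxisymNoSwirlCase`**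
  (the window-fading hypothesis is simply not used), and `target_restricted_of_isBackwardBounded` packaging.

Honest placement: the statement is inside the printed regime (axisymmetric no-swirl Leray–Hopf solutions from smooth
decaying data are globally regular); what is new is only that it is now kernel-checked, and by the zoom/strata route
the doors use.  The lever-exercising rung of S11 OUTSIDE print remains nsreg-p5 g7's screw-slice theorem (p472222).

SUPPORT EDGE (route-NavierStokesRegularity-LocalHelicityTubeDoor born; director-ns g6 #1 (5)): this file is re-pointed
`--supports stmt-NavierStokesRegularity-19974 --as helper` (nsreg-p6 g6 p476304: the leaf in the axisymmetric-no-swirl regime (S-restricted case), supports the Target item); it was parked on the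
CLOSED fallback anchor stmt-NavierStokesRegularity-20018 while the route was unborn.  Declarations unchanged.

WHAT THIS IS NOT: not a claim about Navier–Stokes regularity (Clay A) beyond the classical axisymmetric-no-swirl regime,
and nothing about the open crux K2⁗ — an S-restricted consistency rung for the door family (bears_on LADDER-NS N0).
-/

noncomputable section

-- the summit and its single sub-problem share the name (CONVENTIONS §1), as in every Theorems file
set_option linter.dupNamespace false

namespace Summit.NavierStokesRegularity.NavierStokesRegularity.Theorems.LocalHelicityTubeDoorAxisymNoSwirlCase

open MeasureTheory Set Function Filter Topology TopologicalSpace Metric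
open scoped RealInnerProductSpace InnerProductSpace
open Literature.Analysis Literature.Analysis.FluidPDE
open Summit.NavierStokesRegularity.NavierStokesRegularity.Theorems.LocalVelCompTubeDoorLocalPointZoomVelSlices
open Summit.NavierStokesRegularity.NavierStokesRegularity.Theorems.PoloidalWindowDoorPoloidalWindowRigidityFlat
open Summit.NavierStokesRegularity.NavierStokesRegularity.Theorems.PoloidalWindowDoorPoloidalWindowRigidityAxisymmetric
open Summit.NavierStokesRegularity.NavierStokesRegularity.Theorems.LocalHelicityTubeDoorFrobeniusProfileRigiditySharper

/-! ### Elementary facts about the rotation generator `J` and the rotations `R_θ` -/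

/-- `J (x + c • y) = J x + c • J y`. -/
theorem rotGen_add_smul (x y : EuclideanSpace ℝ (Fin 3)) (c : ℝ) :
    rotGen (x + c • y) = rotGen x + c • rotGen y := by
  rw [rotGen_add, rotGen_smul]

/-- `J x = 0` iff `x` lies on the axis (`x₀ = x₁ = 0`). -/
theorem rotGen_eq_zero_iff (x : EuclideanSpace ℝ (Fin 3)) : rotGen x = 0 ↔ x 0 = 0 ∧ x 1 = 0 := by
  constructor
  · intro h
    have h0 := congrArg (fun w : EuclideanSpace ℝ (Fin 3) => w 0) h
    have h1 := congrArg (fun w : EuclideanSpace ℝ (Fin 3) => w 1) h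
    simp only [rotGen_apply_zero, rotGen_apply_one, PiLp.zero_apply, neg_eq_zero] at h0 h1
    exact ⟨h1, h0⟩
  · rintro ⟨h0, h1⟩
    ext i
    fin_cases i <;> simp [h0, h1]

/-- On the axis the rotations act on `x₀ + λ • y` through `y` only: `R_θ (x₀ + λ y) = x₀ + λ R_θ y`. -/
theorem rotZ_axis_add_smul (θ : ℝ) {x₀ : EuclideanSpace ℝ (Fin 3)} (h0 : x₀ 0 = 0) (h1 : x₀ 1 = 0)
    (c : ℝ) (y : EuclideanSpace ℝ (Fin 3)) : rotZ θ (x₀ + c • y) = x₀ + c • rotZ θ y := by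
  have h := map_add (rotZL θ) x₀ (c • y)
  rw [map_smul] at h
  simp only [rotZL_apply] at h
  rw [h, rotZ_eq_self_of_axis θ h0 h1]

/-- No swirl in inner-product form: `⟪J x, u x⟫ = 0`. -/
theorem inner_rotGen_eq_zero_of_hasNoSwirl {u : EuclideanSpace ℝ (Fin 3) → EuclideanSpace ℝ (Fin 3)}
    (h : HasNoSwirl u) (x : EuclideanSpace ℝ (Fin 3)) : ⟪rotGen x, u x⟫_ℝ = 0 := by
  have := h x
  rw [swirl_eq_inner_rotGen] at this
  exact this

/-! ### The theorem -/

/-- **Local Type I + axisymmetric without swirl ⇒ backward bounded**, at ANY point.  For a classical Navier–Stokes solution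
on `[0,T)` (Leray–Hopf from a rapidly decaying datum) which is axisymmetric about the `x₂`-axis and swirl-free at every
time and locally Type I at `(x₀, T)` on one parabolic cylinder, `u` is backward bounded at `(x₀, T)`.  (By the velocity
zoom of the door family and two settled profile strata: strict shadow off the axis, KNSS Thm 5.2 on the axis.) -/
theorem isBackwardBoundedAt_of_localTypeI_axisymmetric_noSwirl
    (ν T : ℝ) (hν : 0 < ν) (hT : 0 < T) (u : ℝ → EuclideanSpace ℝ (Fin 3) → EuclideanSpace ℝ (Fin 3))
    (p : ℝ → EuclideanSpace ℝ (Fin 3) → ℝ)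
    (hcl : IsClassicalNSSolutionOn (Set.Ico 0 T) ν 0 u p) (hLH : IsLerayHopfOn T ν 0 (u 0) u)
    (hdec : HasRapidSpatialDecay (u 0))
    (hsym : ∀ t, IsAxisymmetric (u t) ∧ HasNoSwirl (u t))
    (x₀ : EuclideanSpace ℝ (Fin 3)) (ρ M : ℝ) (hρ : 0 < ρ)
    (hM : ∀ t ∈ Set.Ico 0 T, T - ρ ^ 2 < t → ∀ x ∈ Metric.ball x₀ ρ, ‖u t x‖ * Real.sqrt (ν * (T - t)) ≤ M) :
    IsBackwardBoundedAt u T x₀ := by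
  by_contra hnot
  obtain ⟨C, v, lam, hlam, hlam0, ⟨hrate, hcont, hmild, hdiv⟩, hsing, hconv⟩ :=
    localPointZoomVelSlices ν T hν hT u p hcl hLH hdec x₀ ρ M hρ hM hnot
  -- the rescaled slices: `U j s y := (λⱼ/ν) • u (T + λⱼ² s/ν) (x₀ + λⱼ • y)`
  -- no swirl at the rescaled points: `⟪J x₀ + λⱼ J y, U j s y⟫ = 0`
  have hsw : ∀ (s : ℝ) (y : EuclideanSpace ℝ (Fin 3)) (j : ℕ),
      ⟪rotGen x₀ + lam j • rotGen y, (lam j / ν) • u (T + lam j ^ 2 * s / ν) (x₀ + lam j • y)⟫_ℝ = 0 := by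
    intro s y j
    rw [real_inner_smul_right, ← rotGen_add_smul,
      inner_rotGen_eq_zero_of_hasNoSwirl (hsym _).2 (x₀ + lam j • y), mul_zero]
  by_cases hax : rotGen x₀ = 0
  · -- ### ON the axis: the limit profile is axisymmetric and swirl-free ⇒ trivial (KNSS Thm 5.2 in the class)
    obtain ⟨h0, h1⟩ := (rotGen_eq_zero_iff x₀).1 hax
    have haxi : ∀ s < 0, IsAxisymmetric (v s) := by
      intro s hs θ y
      -- `U j s (R_θ y) = R_θ (U j s y)` and both sides converge
      have h1' : Tendsto (fun j => (lam j / ν) • u (T + lam j ^ 2 * s / ν) (x₀ + lam j • rotZ θ y)) atTop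
          (𝓝 (v s (rotZ θ y))) := hconv s hs (rotZ θ y)
      have h2' : Tendsto (fun j => rotZ θ ((lam j / ν) • u (T + lam j ^ 2 * s / ν) (x₀ + lam j • y))) atTop
          (𝓝 (rotZ θ (v s y))) :=
        ((rotZL θ).continuous.tendsto _).comp (hconv s hs y)
      have heq : (fun j => (lam j / ν) • u (T + lam j ^ 2 * s / ν) (x₀ + lam j • rotZ θ y)) =
          fun j => rotZ θ ((lam j / ν) • u (T + lam j ^ 2 * s / ν) (x₀ + lam j • y)) := by
        funext j
        rw [← rotZ_axis_add_smul θ h0 h1, (hsym _).1 θ (x₀ + lam j • y)]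
        have := map_smul (rotZL θ) (lam j / ν) (u (T + lam j ^ 2 * s / ν) (x₀ + lam j • y))
        simpa only [rotZL_apply] using this.symm
      rw [heq] at h1'
      exact tendsto_nhds_unique h1' h2'
    have hnsw : ∀ s < 0, HasNoSwirl (v s) := by
      intro s hs y
      rw [swirl_eq_inner_rotGen]
      -- `⟪J y, U j s y⟫ = 0` for every `j` (divide the no-swirl identity by `λⱼ > 0`), pass to the limit
      have hj : ∀ j, ⟪rotGen y, (lam j / ν) • u (T + lam j ^ 2 * s / ν) (x₀ + lam j • y)⟫_ℝ = 0 := by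
        intro j
        have h := hsw s y j
        rw [hax, zero_add, real_inner_smul_left] at h
        rcases mul_eq_zero.1 h with h' | h'
        · exact absurd h' (hlam j).ne'
        · exact h'
      have hlim : Tendsto (fun j => ⟪rotGen y, (lam j / ν) • u (T + lam j ^ 2 * s / ν) (x₀ + lam j • y)⟫_ℝ)
          atTop (𝓝 ⟪rotGen y, v s y⟫_ℝ) :=
        (tendsto_const_nhds (x := rotGen y)).inner (hconv s hs y)
      have hzero : Tendsto (fun j => ⟪rotGen y, (lam j / ν) • u (T + lam j ^ 2 * s / ν) (x₀ + lam j • y)⟫_ℝ)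
          atTop (𝓝 0) := by
        simp only [hj]; exact tendsto_const_nhds
      exact tendsto_nhds_unique hlim hzero
    exact (not_backwardSingular_of_zero (eq_zero_of_axisymmetric_noSwirl hrate hcont hmild hdiv haxi hnsw)) hsing
  · -- ### OFF the axis: the velocity component along `J x₀ ≠ 0` of the limit profile vanishes identically
    have hcomp : ∀ s < 0, ∀ y, ⟪v s y, rotGen x₀⟫_ℝ = 0 := by
      intro s hs y
      rw [real_inner_comm]
      have hlim : Tendsto
          (fun j => ⟪rotGen x₀ + lam j • rotGen y, (lam j / ν) • u (T + lam j ^ 2 * s / ν) (x₀ + lam j • y)⟫_ℝ)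
          atTop (𝓝 ⟪rotGen x₀, v s y⟫_ℝ) := by
        have hJ : Tendsto (fun j => rotGen x₀ + lam j • rotGen y) atTop (𝓝 (rotGen x₀)) := by
          have := (hlam0.smul_const (rotGen y)).const_add (rotGen x₀)
          simpa only [zero_smul, add_zero] using this
        exact hJ.inner (hconv s hs y)
      have hzero : Tendsto
          (fun j => ⟪rotGen x₀ + lam j • rotGen y, (lam j / ν) • u (T + lam j ^ 2 * s / ν) (x₀ + lam j • y)⟫_ℝ)
          atTop (𝓝 0) := by
        simp only [hsw s y]; exact tendsto_const_nhds
      exact tendsto_nhds_unique hlim hzero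
    exact (not_backwardSingular_of_inner_eq_zero hrate hcont hmild hdiv hax hcomp) hsing

/-- **The S-restricted case `TargetAxisymNoSwirlCase` of the S11 leaf is a THEOREM** (statement VERBATIM nsreg-p1 g11's
`bc/rendered-with-scase.lean`; the window-fading hypothesis is idle): a classical Leray–Hopf solution from a rapidly
decaying datum, axisymmetric without swirl at every time and locally Type I at `(x₀,T)`, is backward bounded at `(x₀,T)` —
whatever its scale-normalised helicity density does on the window. -/
theorem targetAxisymNoSwirlCase :
    ∀ (ν T : ℝ), 0 < ν → 0 < T → ∀ (u : ℝ → EuclideanSpace ℝ (Fin 3) → EuclideanSpace ℝ (Fin 3)) (p : ℝ → EuclideanSpace ℝ (Fin 3) → ℝ), Literature.Analysis.FluidPDE.IsClassicalNSSolutionOn (Set.Ico 0 T) ν 0 u p → Literature.Analysis.FluidPDE.IsLerayHopfOn T ν 0 (u 0) u → Literature.Analysis.FluidPDE.HasRapidSpatialDecay (u 0) → (∀ t, Literature.Analysis.FluidPDE.IsAxisymmetric (u t) ∧ Literature.Analysis.FluidPDE.HasNoSwirl (u t)) → ∀ (x₀ : EuclideanSpace ℝ (Fin 3)) (ρ M :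 ℝ), 0 < ρ → (∀ t ∈ Set.Ico 0 T, T - ρ ^ 2 < t → ∀ x ∈ Metric.ball x₀ ρ, ‖u t x‖ * Real.sqrt (ν * (T - t)) ≤ M) → ∀ (U : Set (EuclideanSpace ℝ (Fin 3))), IsOpen U → U.Nonempty → Filter.Tendsto (fun t => ∫⁻ y in U, ENNReal.ofReal |Real.sqrt (T - t) ^ 3 * inner ℝ (u t (x₀ + Real.sqrt (T - t) • y)) (Literature.Analysis.FluidPDE.curl (u t) (x₀ + Real.sqrt (T - t) • y))|) (nhdsWithin T (Set.Iio T)) (nhds 0) → Literature.Analysis.FluidPDE.IsBackwardBoundedAt u T x₀ :=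
  fun ν T hν hT u p hcl hLH hdec hsym x₀ ρ M hρ hM _ _ _ _ =>
    isBackwardBoundedAt_of_localTypeI_axisymmetric_noSwirl ν T hν hT u p hcl hLH hdec hsym x₀ ρ M hρ hM

end Summit.NavierStokesRegularity.NavierStokesRegularity.Theorems.LocalHelicityTubeDoorAxisymNoSwirlCase

end
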